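import Mathlib
import HarnessLib
import Summits.ABC.ABC.Theses.CongruentialReceptacle
import Summits.ABC.ABC.Theorems.CongruentialReceptacleReceptacleIdentityStableSzpiroDefs

/-!
# Crux `ReceptacleIdentity` (stmt-ABC-1813), line `stable-szpiro-duality`: stub A2

Registered stub `stub_phi_eq_linGain_of_matched` of the checked skeleton
`Cruxes/ReceptacleIdentity/Lines/stable_szpiro_duality.lean`:

  `∀ (κ c₁ c₁' ε : ℝ) (F : SignedFamily κ), F.Matched → Phi c₁ c₁' ε F.bdry = c₁ * F.linGain ε`.

On a residue-MATCHED family (`∂F ≥ 0`) the box functional `Φ` is LINEAR and `c₁'`-free: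
`Φ(∂F) = c₁ · Σ_T w_T · s_T` with `s_T = 2 log(abc) − (6+ε) log rad(abc)`.

Proof. (1) On `μ ≥ 0` the negative parts vanish, so `Φ(μ) = Σ_d μ(d) · lowerW(d)`.
(2) The pairing `μ ↦ Σ_d μ(d) · x(d)` is `Finsupp.linearCombination ℝ x`, hence linear, and
`∂F = Σ_T w_T Σ_{p ∣ abc} δ_{D_p T}`, so `Σ_d (∂F)(d) · lowerW(d) = Σ_T w_T Σ_{p ∣ abc} lowerW(D_p T)`.
(3) Per triple, with `N := abc ≠ 0`: `v_p a + v_p b + v_p c = v_p N`,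
`Σ_{p ∣ N} v_p(N) log p = log N` and `Σ_{p ∣ N} log p = log rad(abc)`, so
`Σ_{p ∣ N} c₁ (2 v_p(N) − 6 − ε) log p = c₁ (2 log N − (6+ε) log rad(abc)) = c₁ · s_T`.

No literature input. Uses the landed Defs file (p133899); the linearity helper is copied from the
sibling stub file `…StubStableSzpiroOfTLR` (p134656), the per-triple logarithmic identities from the
glue proof `…TameLocalReceptacleGivesTarget`.
-/

-- `Summit.<Summit>.<Problem>` is the mandated summit-side namespace (CONVENTIONS §2); for the
-- single-conjunct summit `ABC` the two coincide, so the duplicate `ABC.ABC` is deliberate.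
set_option linter.dupNamespace false

namespace Summit.ABC.ABC.Theorems.StableSzpiro

open Literature.NumberTheory.DiophantineGeometry (IsABCTriple rad)
open Summit.ABC.ABC.Theses.CongruentialReceptacle
open Finset

variable {κ : ℝ}

/-- On a nonnegative class the negative parts vanish: `Φ(μ) = Σ_d μ(d) · lowerW(d)` whenever
`μ ≥ 0` pointwise (in particular `Φ` does not see `c₁'` there). [folklore] -/
private theorem Phi_eq_sum_mul_lowerW_of_nonneg {c₁ c₁' ε : ℝ} (μ : Datum →₀ ℝ)
    (hμ : ∀ d : Datum, 0 ≤ μ d) :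
    Phi c₁ c₁' ε μ = μ.sum (fun d m => m * lowerW c₁ ε d) := by
  unfold Phi Finsupp.sum
  refine Finset.sum_congr rfl fun d _ => ?_
  dsimp only
  rw [max_eq_left (hμ d), max_eq_right (neg_nonpos.mpr (hμ d)), zero_mul, sub_zero]

/-- Linearity of the pairing: `Σ_d (∂F)(d) · x(d) = Σ_T w_T Σ_{p ∣ abc} x(D_p T)`
(the pairing is `Finsupp.linearCombination ℝ x`). [folklore] -/
-- adapted from the sibling stub file `…ReceptacleIdentityStubStableSzpiroOfTLR` (private there)
private theorem bdry_sum_mul (F : SignedFamily κ) (x : Datum → ℝ) :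
    F.bdry.sum (fun d m => m * x d) =
      ∑ T ∈ F.supp, F.w T * ∑ p ∈ (T.1 * T.2.1 * T.2.2).primeFactors, x (datumAt T.1 T.2.1 T.2.2 p) := by
  have key : ∀ μ : Datum →₀ ℝ, μ.sum (fun d m => m * x d) = Finsupp.linearCombination ℝ x μ :=
    fun μ => rfl
  rw [key, SignedFamily.bdry, map_sum]
  refine Finset.sum_congr rfl fun T _ => ?_
  rw [map_smul, boundary, map_sum, smul_eq_mul]
  congr 1
  refine Finset.sum_congr rfl fun p _ => ?_
  rw [Finsupp.linearCombination_single, one_smul]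

/-- Per triple: the lower windows summed over `p ∣ abc` give `c₁` times the Szpiro excess,
`Σ_{p ∣ abc} c₁ (2 (v_p a + v_p b + v_p c) − 6 − ε) log p = c₁ (2 log(abc) − (6+ε) log rad(abc))`,
for `a, b, c ≠ 0` (via `Σ_p v_p(N) log p = log N` and `Σ_{p ∣ N} log p = log rad`). [folklore] -/
private theorem sum_lowerW_datumAt {c₁ ε : ℝ} {a b c : ℕ} (ha0 : a ≠ 0) (hb0 : b ≠ 0)
    (hc0 : c ≠ 0) :
    ∑ p ∈ (a * b * c).primeFactors, lowerW c₁ ε (datumAt a b c p) = c₁ * szpiroExcess ε a b c := by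
  unfold szpiroExcess
  set N : ℕ := a * b * c with hN
  -- valuations add up: v_p a + v_p b + v_p c = v_p N
  have hfac : ∀ p : ℕ, a.factorization p + b.factorization p + c.factorization p
      = N.factorization p := by
    intro p
    simp only [hN, Nat.factorization_mul (mul_ne_zero ha0 hb0) hc0, Nat.factorization_mul ha0 hb0,
      Finsupp.coe_add, Pi.add_apply]
  -- Σ_p v_p(N) log p = log N and Σ_{p ∣ N} log p = log rad(abc)
  have hlogN : ∑ p ∈ N.primeFactors, ((N.factorization p : ℕ) : ℝ) * Real.log p = Real.log N := by
    rw [Real.log_nat_eq_sum_factorization, Finsupp.sum, Nat.support_factorization]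
  have hlogR : ∑ p ∈ N.primeFactors, Real.log p = Real.log ((rad a b c : ℕ) : ℝ) := by
    rw [Literature.NumberTheory.DiophantineGeometry.rad_def, ← hN, Nat.radical_eq_prod_primeFactors,
      Nat.cast_prod, Real.log_prod]
    intro p hp
    exact_mod_cast (Nat.prime_of_mem_primeFactors hp).ne_zero
  rw [← hlogN, ← hlogR, Finset.mul_sum, Finset.mul_sum, ← Finset.sum_sub_distrib, Finset.mul_sum]
  refine Finset.sum_congr rfl fun p _ => ?_
  have hlow : lowerW c₁ ε (datumAt a b c p) =
      c₁ * (2 * ((a.factorization p + b.factorization p + c.factorization p : ℕ) : ℝ) - 6 - ε) *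
        Real.log p := rfl
  rw [hlow, hfac p]
  ring

/-- **Stub A2 of line `stable-szpiro-duality` (crux stmt-ABC-1813).** On a residue-matched signed
family (`∂F ≥ 0`) the box functional is linear and `c₁'`-free:
`Φ_{c₁,c₁',ε}(∂F) = c₁ · Σ_T w_T · (2 log(abc) − (6+ε) log rad(abc))`. [folklore] -/
theorem stub_phi_eq_linGain_of_matched :
    ∀ (κ c₁ c₁' ε : ℝ) (F : SignedFamily κ), F.Matched →
      Phi c₁ c₁' ε F.bdry = c₁ * F.linGain ε := by
  intro κ c₁ c₁' ε F hM
  rw [Phi_eq_sum_mul_lowerW_of_nonneg F.bdry hM, bdry_sum_mul F (lowerW c₁ ε), SignedFamily.linGain,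
    Finset.mul_sum]
  refine Finset.sum_congr rfl fun T hT => ?_
  obtain ⟨habc, -, -⟩ := F.balanced T hT
  have ha0 : T.1 ≠ 0 := Nat.pos_iff_ne_zero.mp habc.1
  have hb0 : T.2.1 ≠ 0 := Nat.pos_iff_ne_zero.mp habc.2.1
  have hc0 : T.2.2 ≠ 0 := by
    have := habc.2.2.1
    omega
  rw [sum_lowerW_datumAt ha0 hb0 hc0]
  ring

end Summit.ABC.ABC.Theorems.StableSzpiro
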